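import Summits.AtomisticToContinuum.BoseEinsteinCondensation.Theses.BECChargeConjugationRP

/-!
# Birth skeleton — crux `CornerTransfer` (route `BECChargeConjugationRP`, item stmt-AtomisticToContinuum-9047)

Line `birth` (skeleton-register, BC3).  The crux is the NON-RELATIVISTIC CORNER TRANSFER:

  `RelCornerLRO → ∃ ε₀ > 0, ∀ Born-regime v, PeriodicBEC-body(v)`,

i.e. uniform zero-mode intensity `⟨|Σ_x Φ_x|²⟩ ≥ κ N n³` of the sector-`N` near-ground states of the
lattice relativistic Bose gas `H_c` (kernel `K = b² v^per(b·)`, `b = L/n`, `L = (N/ρ)^{1/3}`), for all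
large `N`, all large even `n` and all large `c`, implies constant-mode condensation
`n₀ ≥ c·N` of the near-ground states of the continuum periodic `N`-body problem.

The cut follows the route's own two-layer plan (`CornerTransfer ⇐ NRLimit → ContinuumLimit`, the
middle object being the lattice Bose gas, typed here inline: `latticeEnergy`, `latticeTrial`,
`latticeZeroMode`), plus the honest residue that the typing of the crux forces:

* `stub_nonrelativisticLimit` — `c → ∞` AT FIXED `(N, n)`: adiabatic elimination of the pair modes
  (gap `2c²`).  The lowest Landau-type level `P = span{Φ^α e^{-|Φ|²/2} : |α| = N}` of
  `c² Σ_x(−½Δ_Φx + ½|Φ_x|² − 1)` in the charge sector `N` is the `N`-boson lattice space; on it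
  `P |Φ_x|² P = n_x + 1`, `P Φ̄_xΦ_y P = a†_y a_x`, `P|Φ_x|²|Φ_y|²P = (n_x+1)(n_y+1) + δ_xy(n_x+1)`, so
  `P H₁ P` = graph-Laplacian hopping + `½Σ_{j≠k} K(X_j,X_k)` + const (translation invariance of `K`),
  and `⟨|ΣΦ|²⟩ = n³(N₀ + 1)` EXACTLY on `P`.  Schur/Feshbach lower bound
  `inf_sector E_c ≥ c²(n³+N) + λ₀(PH₁P) − O(‖P^⊥H₁P‖²/c²)`, sector ground states exist and are smooth,
  converge to the (Perron–Frobenius unique) lattice ground state, `⟨|ΣΦ|²⟩` converges by a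
  second-moment bound; continuity of `N₀` on the finite-dimensional lattice sphere gives the loss `+2`.
  Size L.  [Kato / ReedSimon IV §XII analytic perturbation of a discrete eigenvalue at fixed sizes;
  Bravyi–DiVincenzo–Loss 2011 (Schrieffer–Wolff); grounder note g15-18.]
* `stub_continuumLimit` — `b = L/n → 0` AT FIXED `N` for a RIEMANN-REGULAR profile
  (`volume {r | ¬ContinuousAt v r} = 0`, bounded): the lattice forms `b⁻²[−Δ_lat + K]` (point samples
  `K/b² = v^per(b(X_j − X_k))`) Mosco-converge to `Σ−Δ_j + Σ_{j<k} v^per(x_j−x_k)` on the torus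
  (recovery by sampling smooth states = Riemann sums of an a.e.-continuous bounded integrand; liminf via
  continuous minorants `0 ≤ V_η ≤ V`, `∫(V−V_η) < η`, which exist iff `V` is Riemann integrable),
  discrete Rellich compactness, uniqueness + gap of the periodic ground state (bounded `v^per`,
  positivity improving), `N₀ → n₀` along piecewise-constant embeddings, and Lipschitz continuity of
  `Ψ ↦ n₀(Ψ)` (`≤ N`·projection) on the unit sphere for the near-minimiser sets; losses `−2 → −3`.
  Size L.  [standard finite-difference Γ/Mosco convergence; LSSY2005 §1.2; Fournais2020 (1.1)–(1.5).]
* `stub_periodicUniversality` — THE RESIDUE.  `IsRepulsiveFiniteRange` asks only MEASURABILITY of `v`,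
  while the lattice model of `RelCornerLRO` POINT-SAMPLES `v^per` on the countable grids
  `(N/ρ)^{1/3}·ℤ³/n`; a bounded profile with no Riemann-integrable representative (height `ε₀/R²` times
  the indicator of a fat Cantor set of radii avoiding every grid radius) is invisible to every lattice
  model (free lattice gas, hypothesis vacuous) yet genuinely interacting in the continuum (a.e.-class).
  For such `v` the crux as typed is periodic-BEC-hard; the only honest bridge is universality of dilute
  periodic condensation in the scattering length (the periodic twin of the route's own crux #7
  `ScatteringLengthTransfer`, bounded potentials on both sides).  Size XL / conjectural.  It becomes
  VACUOUS — and this line collapses to the first two stubs — once the route planner restates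
  `CornerTransfer` (and `BornRepresentativesExist`) with the clause `volume {r | ¬ContinuousAt v r} = 0`
  in the Born hypothesis; RESTATE RECOMMENDED (see `Lines/birth.md`).  [LSSY2005 Ch. 2 after (2.8).]
* `stub_regularBornRepresentatives` — every `a ≥ 0` has a Riemann-regular Born-window representative
  (the square well of `exists_bornRepresentative`, whose only discontinuity radius is `R`).  Size S/M,
  provable now.  [LSSY2005 App. C Thm C.1; tree: `scatteringLength_squareWell`.]

`cornerTransfer_of_parts : NonrelativisticLimit → ContinuumLimit → PeriodicUniversality →
RegularBornRepresentatives → RelCornerLRO → (consequent of CornerTransfer)` is the kernel-checked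
assembly (real proof, no `sorry`; the four `def … : Prop` are the stub statements, restated verbatim as
the types of the `stub_*` theorems): given `RelCornerLRO` with window `ε₀`, for a Born `w` take the
regular representative `u` of `a(w)` (finite by `ScatteringLengthFinite_holds`), run `RelCornerLRO` on
`u`, feed each `(N, n)`-slice through the NR limit and the `N`-slice through the continuum limit with
threshold `a := κN`, obtaining `n₀ ≥ κN − 3 ≥ (κ/2)N` for `N ≥ 6/κ`, and transfer periodic
condensation from `u` to `w`.  `CornerTransfer_of : CornerTransfer` (the registered skeleton theorem,
the only theorem here concluding the crux BY NAME) applies it to the four stubs BY NAME.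

Disproof used: none on file (`ledger crux ls stmt-AtomisticToContinuum-9047`: no workfiles; the three
negatives of the summit are unrelated).  Sorries: exactly the four `stub_*`.
-/

noncomputable section

namespace Summit.AtomisticToContinuum.BoseEinsteinCondensation.Cruxes.CornerTransfer.Birth

open scoped BigOperators Topology Manifold Classical MeasureTheory ProbabilityTheory Matrix InnerProductSpace ComplexConjugate ContinuousMap
open scoped ENNReal NNReal
open Filter Set Function TopologicalSpace MeasureTheory
open Literature.MathematicalPhysics.QuantumManyBody.BoseGas
open Summit.AtomisticToContinuum.BoseEinsteinCondensation.Theses.BECChargeConjugationRP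
  (RelCornerLRO CornerTransfer ScatteringLengthFinite_holds)

/-! ### Shorthands (verbatim fragments of the route file) -/

/-- The Born window of width `ε`: some range `R > 0` beyond which `v` vanishes and height
`v ≤ ε/R²` (verbatim the Born hypothesis of `RelCornerLRO` / `CornerTransfer`). -/
def Born (ε : ℝ) (v : ℝ → ℝ≥0∞) : Prop :=
  ∃ R : ℝ, 0 < R ∧ (∀ r, R < r → v r = 0) ∧ ∀ r, v r ≤ ENNReal.ofReal (ε / R ^ 2)

/-- Riemann regularity of a bounded profile: continuous at almost every radius (Lebesgue's
criterion).  Square wells and every piecewise-continuous profile qualify; the indicator of a fat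
Cantor set does not, for any representative of its a.e.-class. -/
def RiemannRegular (v : ℝ → ℝ≥0∞) : Prop :=
  volume {r : ℝ | ¬ ContinuousAt v r} = 0

/-- Constant-mode condensation of the periodic near-ground states at every small density — verbatim
the conclusion of `CornerTransfer` for one potential `v` (the PeriodicBEC body of stmt-0826). -/
def PeriodicCondensation (v : ℝ → ℝ≥0∞) : Prop :=
  ∃ ρ₀ : ℝ, 0 < ρ₀ ∧ ∀ ρ : ℝ, 0 < ρ → ρ < ρ₀ → ∃ c : ℝ, 0 < c ∧ ∀ᶠ N : ℕ in Filter.atTop,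
    ∃ δ : ENNReal, 0 < δ ∧ ∀ Ψ : PeriodicTrialState N (sideLength ρ N),
      periodicEnergy v Ψ ≤ periodicGroundStateEnergy v N (sideLength ρ N) + δ →
        ENNReal.ofReal (c * N) ≤ condensateOccupation N (sideLength ρ N) Ψ.ψ

/-- The sector-`N` zero-mode bound of the lattice relativistic Bose gas `H_c` at `(v, ρ, N, n, c)`
with threshold `A`: every `δ`-near-minimiser `Ψ` of the sector-`N` energy has
`A ≤ ∫ |Σ_x Φ_x|² |Ψ|²`.  VERBATIM the `let … ; ∃ δ, …` block of `RelCornerLRO`, with its threshold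
`ENNReal.ofReal (κ * N * n ^ 3)` generalised to `A` (so that `RelCornerLRO` supplies
`∃ c₀, ∀ c ≥ c₀, RelZeroModeBound v ρ N n c (ENNReal.ofReal (κ * N * n ^ 3))` definitionally). -/
def RelZeroModeBound (v : ℝ → ℝ≥0∞) (ρ : ℝ) (N n : ℕ) [NeZero n] (c : ℝ) (A : ℝ≥0∞) : Prop :=
  let L := sideLength ρ N; let b := L / n; let pos : (Fin 3 → ZMod n) → EuclideanSpace ℝ (Fin 3) := fun x => WithLp.toLp 2 (fun i => b * ((x i).val : ℝ)); let U : ((Fin 3 → ZMod n) → ℂ) → ENNReal := fun Φ => ENNReal.ofReal (∑ x, (c ^ 2 / 2 * ‖Φ x‖ ^ 2 + ∑ i : Fin 3, ‖Φ (x + Pi.single i 1) - Φ x‖ ^ 2)) + (∑ x, ∑ y, ENNReal.ofReal (b ^ 2) * periodizedPotential v L (pos x - pos y) * (‖Φ x‖₊ : ENNReal) ^ 2 * (‖Φ y‖₊ : ENNReal) ^ 2) / 2; let E : (((Fin 3 → ZMod n) → ℂ) → ℂ) → ENNReal := fun Ψ => ∫⁻ Φ, ENNReal.ofReal (c ^ 2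 / 2) * (∑ x, ((‖fderiv ℝ Ψ Φ (Pi.single x 1)‖₊ : ENNReal) ^ 2 + (‖fderiv ℝ Ψ Φ (Pi.single x Complex.I)‖₊ : ENNReal) ^ 2)) + U Φ * (‖Ψ Φ‖₊ : ENNReal) ^ 2; let T : (((Fin 3 → ZMod n) → ℂ) → ℂ) → Prop := fun Ψ => ContDiff ℝ 1 Ψ ∧ ∫⁻ Φ, (‖Ψ Φ‖₊ : ENNReal) ^ 2 = 1 ∧ ∀ (θ : ℝ) (Φ : (Fin 3 → ZMod n) → ℂ), Ψ (fun x => Complex.exp (θ * Complex.I) * Φ x) = Complex.exp (N * θ * Complex.I) * Ψ Φ; ∃ δ : ENNReal, 0 < δ ∧ ∀ Ψ, T Ψ → E Ψ ≤ (⨅ (Ψ' : ((Fin 3 → ZMod n) → ℂ) → ℂ) (_ : T Ψ'), E Ψ') + δ → A ≤ ∫⁻ Φ, (‖∑ x, Φ x‖₊ : ENNReal) ^ 2 * (‖Ψ Φ‖₊ : ENNReal) ^ 2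

/-! ### The middle object: the lattice Bose gas of the non-relativistic corner

`N` bosons on the discrete torus `(ℤ/nℤ)³` with hopping `1` (graph-Laplacian quadratic form) and the
pair kernel `K(x, y) = b² v^per_L(pos x − pos y)` of `RelCornerLRO`; `b⁻²(−Δ_lat + K)` is the
finite-difference discretisation, at spacing `b = L/n`, of `Σ_j −Δ_j + Σ_{j<k} v^per(x_j − x_k)` on the
torus of side `L`. -/

/-- Sites of the discrete torus `(ℤ/nℤ)³`. -/
abbrev Site (n : ℕ) : Type := Fin 3 → ZMod n

/-- The pair kernel `K(x, y) = b² · v^per_L(pos x − pos y)` of `RelCornerLRO` (`L = (N/ρ)^{1/3}`,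
`b = L/n`, `pos x = b · (x₁.val, x₂.val, x₃.val)`): `b²` times the continuum periodised pair
potential POINT-SAMPLED at the lattice separation. -/
def latticeKernel (v : ℝ → ℝ≥0∞) (ρ : ℝ) (N n : ℕ) [NeZero n] (x y : Site n) : ℝ≥0∞ :=
  ENNReal.ofReal ((sideLength ρ N / n) ^ 2) *
    periodizedPotential v (sideLength ρ N)
      (WithLp.toLp 2 (fun i => sideLength ρ N / n * ((x i).val : ℝ)) -
        WithLp.toLp 2 (fun i => sideLength ρ N / n * ((y i).val : ℝ)))

/-- Bosonic lattice trial states: `ψ : ((ℤ/nℤ)³)^N → ℂ` symmetric under permutations of the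
particles and `ℓ²`-normalised. -/
def latticeTrial (N n : ℕ) [NeZero n] (ψ : (Fin N → Site n) → ℂ) : Prop :=
  (∀ (σ : Equiv.Perm (Fin N)) (X : Fin N → Site n), ψ (X ∘ σ) = ψ X) ∧
    ∑ X, (‖ψ X‖₊ : ℝ≥0∞) ^ 2 = 1

/-- The lattice `N`-body energy `⟨ψ, (−Δ_lat + K) ψ⟩`: nearest-neighbour hopping of amplitude `1`
written as the graph-Laplacian form `Σ_X Σ_j Σ_i |ψ(X + e_i^{(j)}) − ψ(X)|²`, plus the pair kernel
over unordered pairs (same-site pairs included, value `K(x, x)`), which is `P H₁ P` of the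
relativistic model up to an additive constant in the sector. -/
def latticeEnergy (v : ℝ → ℝ≥0∞) (ρ : ℝ) (N n : ℕ) [NeZero n] (ψ : (Fin N → Site n) → ℂ) :
    ℝ≥0∞ :=
  ∑ X, ((∑ j : Fin N, ∑ i : Fin 3,
      (‖ψ (Function.update X j (X j + Pi.single i 1)) - ψ X‖₊ : ℝ≥0∞) ^ 2) +
    (∑ j : Fin N, ∑ k : Fin N with j < k, latticeKernel v ρ N n (X j) (X k)) *
      (‖ψ X‖₊ : ℝ≥0∞) ^ 2)

/-- The zero-momentum occupation `N₀(ψ) = Σ_j ‖P₀^{(j)} ψ‖² = Σ_j Σ_X |n⁻³ Σ_y ψ(X[j ↦ y])|²`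
(expected number of particles in the constant one-body mode; `= N⟨ψ, P₀ ⊗ 1 ψ⟩` for symmetric `ψ`). -/
def latticeZeroMode (N n : ℕ) [NeZero n] (ψ : (Fin N → Site n) → ℂ) : ℝ≥0∞ :=
  ∑ j : Fin N, ∑ X : Fin N → Site n,
    (‖(∑ y : Site n, ψ (Function.update X j y)) / ((n : ℂ) ^ 3)‖₊ : ℝ≥0∞) ^ 2

/-- Lattice condensate bound with threshold `a`: for some `δ > 0` every bosonic `δ`-near-minimiser of
the lattice energy has `N₀(ψ) ≥ a − 2` (written additively in `ℝ≥0∞`). -/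
def LatticeCondensateBound (v : ℝ → ℝ≥0∞) (ρ : ℝ) (N n : ℕ) [NeZero n] (a : ℝ) : Prop :=
  ∃ δ : ℝ≥0∞, 0 < δ ∧ ∀ ψ : (Fin N → Site n) → ℂ, latticeTrial N n ψ →
    latticeEnergy v ρ N n ψ ≤
        (⨅ (ψ' : (Fin N → Site n) → ℂ) (_ : latticeTrial N n ψ'), latticeEnergy v ρ N n ψ') + δ →
      ENNReal.ofReal a ≤ latticeZeroMode N n ψ + 2

/-! ### The four stub statements -/

/-- Statement of Stub 1 (non-relativistic limit `c → ∞` at fixed `N, n`). -/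
def NonrelativisticLimit : Prop :=
  ∀ (v : ℝ → ℝ≥0∞) (ρ : ℝ) (N n : ℕ) [NeZero n] (a : ℝ),
    IsRepulsiveFiniteRange v → (∃ M : NNReal, ∀ r, v r ≤ M) → 0 < ρ →
    (∃ c₀ : ℝ, ∀ c : ℝ, c₀ ≤ c → RelZeroModeBound v ρ N n c (ENNReal.ofReal (a * (n : ℝ) ^ 3))) →
    LatticeCondensateBound v ρ N n a

/-- Statement of Stub 2 (continuum limit `b = L/n → 0` at fixed `N`, Riemann-regular profile). -/
def ContinuumLimit : Prop :=
  ∀ (v : ℝ → ℝ≥0∞) (ρ : ℝ) (N : ℕ) (a : ℝ),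
    IsRepulsiveFiniteRange v → (∃ M : NNReal, ∀ r, v r ≤ M) → RiemannRegular v → 0 < ρ → 1 ≤ N →
    (∃ n₀ : ℕ, ∀ (n : ℕ) [NeZero n], Even n → n₀ ≤ n → LatticeCondensateBound v ρ N n a) →
    ∃ δ : ENNReal, 0 < δ ∧ ∀ Ψ : PeriodicTrialState N (sideLength ρ N),
      periodicEnergy v Ψ ≤ periodicGroundStateEnergy v N (sideLength ρ N) + δ →
        ENNReal.ofReal (a - 3) ≤ condensateOccupation N (sideLength ρ N) Ψ.ψ

/-- Statement of Stub 3 (universality of dilute periodic condensation in the scattering length,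
bounded potentials, from a Riemann-regular one). -/
def PeriodicUniversality : Prop :=
  ∀ v w : ℝ → ℝ≥0∞, IsRepulsiveFiniteRange v → IsRepulsiveFiniteRange w →
    (∃ M : NNReal, ∀ r, v r ≤ M) → (∃ M : NNReal, ∀ r, w r ≤ M) → RiemannRegular v →
    scatteringLength v = scatteringLength w → PeriodicCondensation v → PeriodicCondensation w

/-- Statement of Stub 4 (Riemann-regular Born-window representatives of every scattering length). -/
def RegularBornRepresentatives : Prop :=
  ∀ ε : ℝ, 0 < ε → ∀ a : ℝ, 0 ≤ a → ∃ v : ℝ → ℝ≥0∞, IsRepulsiveFiniteRange v ∧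
    (∃ M : NNReal, ∀ r, v r ≤ M) ∧ Born ε v ∧ RiemannRegular v ∧
      scatteringLength v = ENNReal.ofReal a

/-! ### Stubs -/

/-- **Stub 1 — non-relativistic limit (adiabatic elimination of the pair modes), fixed `N, n`.**
For a bounded finite-range profile `v`, density `ρ > 0`, particle number `N`, lattice size `n` and a
threshold `a`: if for all large `c` every near-minimiser of the sector-`N` energy of `H_c` has
zero-mode intensity `∫|Σ_xΦ_x|²|Ψ|² ≥ a·n³`, then every bosonic near-minimiser `ψ` of the lattice
Bose gas `−Δ_lat + K` has `N₀(ψ) ≥ a − 2`.  Mechanism: embed `ψ ↦ ψ(a†) Ω ∈ P` (smooth, sector-`N`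
covariant, `⟨|ΣΦ|²⟩ = n³(N₀(ψ)+1)` exactly); the sector ground states of `H_c` exist, are `C^∞`,
and converge to the embedded Perron–Frobenius lattice ground state as `c → ∞` with
`E_c = c²(n³+N) + λ₀(PH₁P) + O(c⁻²)` (Schur complement on `P^⊥`, gap `≥ c²`), second moments of
`Σ|Φ_x|²` bounded uniformly in `c`; continuity of `N₀` on the finite-dimensional unit sphere.
[Kato, ReedSimon IV §XII; Bravyi–DiVincenzo–Loss 2011; LSSY2005 §1.2 for `N₀`.] -/
theorem stub_nonrelativisticLimit :
    ∀ (v : ℝ → ℝ≥0∞) (ρ : ℝ) (N n : ℕ) [NeZero n] (a : ℝ),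
      IsRepulsiveFiniteRange v → (∃ M : NNReal, ∀ r, v r ≤ M) → 0 < ρ →
      (∃ c₀ : ℝ, ∀ c : ℝ, c₀ ≤ c → RelZeroModeBound v ρ N n c (ENNReal.ofReal (a * (n : ℝ) ^ 3))) →
      LatticeCondensateBound v ρ N n a := by
  sorry

/-- **Stub 2 — continuum limit of the lattice Bose gas, fixed `N` (load-bearing for the route's
"uniform in the regularisation").**  For a bounded finite-range RIEMANN-REGULAR profile `v`, `ρ > 0`,
`N ≥ 1` and a threshold `a`: if for all large even `n` every bosonic near-minimiser of the lattice gas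
at spacing `b = (N/ρ)^{1/3}/n` has `N₀ ≥ a − 2`, then every periodic `C¹` near-minimiser `Ψ` of
`Σ−Δ_j + Σ_{j<k} v^per(x_j − x_k)` on the torus of side `(N/ρ)^{1/3}` has `n₀(Ψ) ≥ a − 3`.
Mechanism: Mosco convergence of `b⁻²(−Δ_lat + K)` (point-sampled `v^per`) to the continuum form —
recovery sequences by sampling smooth states (Riemann sums of an a.e.-continuous bounded
integrand), liminf through continuous minorants `V_η ≤ V`, `∫(V − V_η) < η` — discrete Rellich
compactness, simplicity and gap of the periodic ground state (bounded `v^per`, positivity-improving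
semigroup), `N₀ →  n₀` along piecewise-constant embeddings, and `|n₀(Ψ) − n₀(Ψ₀)| ≤ 2N‖Ψ − Ψ₀‖`.
FALSE without `RiemannRegular` (fat-Cantor profile: every lattice model is the free gas).
[finite-difference Γ-convergence, standard; LSSY2005 §1.2 (1.17); Fournais2020 (1.3)–(1.5).] -/
theorem stub_continuumLimit :
    ∀ (v : ℝ → ℝ≥0∞) (ρ : ℝ) (N : ℕ) (a : ℝ),
      IsRepulsiveFiniteRange v → (∃ M : NNReal, ∀ r, v r ≤ M) → RiemannRegular v → 0 < ρ → 1 ≤ N →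
      (∃ n₀ : ℕ, ∀ (n : ℕ) [NeZero n], Even n → n₀ ≤ n → LatticeCondensateBound v ρ N n a) →
      ∃ δ : ENNReal, 0 < δ ∧ ∀ Ψ : PeriodicTrialState N (sideLength ρ N),
        periodicEnergy v Ψ ≤ periodicGroundStateEnergy v N (sideLength ρ N) + δ →
          ENNReal.ofReal (a - 3) ≤ condensateOccupation N (sideLength ρ N) Ψ.ψ := by
  sorry

/-- **Stub 3 — universality residue (conjectural, XL; vacuous after the recommended restate).**
For bounded finite-range profiles `v, w` with equal scattering length, `v` Riemann-regular:
constant-mode condensation of the periodic near-ground states at all small densities transfers from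
`v` to `w`.  This is the periodic-box twin of the route's crux `ScatteringLengthTransfer`
(stmt-4285, Dirichlet); it is here ONLY because `CornerTransfer` quantifies over merely measurable
Born profiles, which the point-sampling lattice model of `RelCornerLRO` cannot see (a.e.-class vs.
grid values).  False iff LSSY's open question (Ch. 2 after (2.8): do equal-`a` soft gases differ
w.r.t. BEC?) resolves negatively inside the bounded class. [LSSY2005 Ch. 2; LiebYngvason1998.] -/
theorem stub_periodicUniversality :
    ∀ v w : ℝ → ℝ≥0∞, IsRepulsiveFiniteRange v → IsRepulsiveFiniteRange w →
      (∃ M : NNReal, ∀ r, v r ≤ M) → (∃ M : NNReal, ∀ r, w r ≤ M) → RiemannRegular v →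
      scatteringLength v = scatteringLength w → PeriodicCondensation v → PeriodicCondensation w := by
  sorry

/-- **Stub 4 — Riemann-regular Born representatives (provable now, S/M).**  For `ε > 0` and `a ≥ 0`
there is a bounded measurable finite-range profile in the Born window `v ≤ ε/R²`, continuous off a
null set of radii, with `scatteringLength v = a`: the square well
`(Set.Iic R).indicator (fun _ => ENNReal.ofReal (ε/R²))`, `R = a/(1 − tanh Y/Y)`, `Y = √(ε/2)`, of
`exists_bornRepresentative` (discontinuous only at `r = R`), and `v = 0` for `a = 0`.
[LSSY2005 App. C Thm C.1; tree `scatteringLength_squareWell`, `exists_bornRepresentative`.] -/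
theorem stub_regularBornRepresentatives :
    ∀ ε : ℝ, 0 < ε → ∀ a : ℝ, 0 ≤ a → ∃ v : ℝ → ℝ≥0∞, IsRepulsiveFiniteRange v ∧
      (∃ M : NNReal, ∀ r, v r ≤ M) ∧ Born ε v ∧ RiemannRegular v ∧
        scatteringLength v = ENNReal.ofReal a := by
  sorry

/-! ### Assembly -/

/-- **Assembly, body form (kernel-checked, no `sorry`).** The four stub statements and `RelCornerLRO`
give the consequent of `CornerTransfer` (Born window `ε₀`, periodic condensation of every Born `w`).
Given `RelCornerLRO` with Born window `ε₀` and a Born profile `w`: take a Riemann-regular Born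
representative `u` of `a(w)` (Stub 4; `a(w) < ∞` by `ScatteringLengthFinite_holds`), run
`RelCornerLRO` on `u`; for `ρ < ρ₀(u)` with constant `κ`, feed every `(N, n)`-slice of the lattice
relativistic bound (threshold `κ N n³`) through Stub 1 and the resulting lattice condensate bounds
(threshold `κ N`) through Stub 2: periodic near-minimisers of `u` have `n₀ ≥ κN − 3 ≥ (κ/2) N` once
`N ≥ 6/κ`; Stub 3 carries `PeriodicCondensation u` to `w`. -/
theorem cornerTransfer_of_parts (h1 : NonrelativisticLimit) (h2 : ContinuumLimit)
    (h3 : PeriodicUniversality) (h4 : RegularBornRepresentatives) (hRel : RelCornerLRO) :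
    ∃ ε₀ : ℝ, 0 < ε₀ ∧ ∀ w : ℝ → ℝ≥0∞, IsRepulsiveFiniteRange w → Born ε₀ w →
      PeriodicCondensation w := by
  obtain ⟨ε₀, hε₀, hcorner⟩ := hRel
  refine ⟨ε₀, hε₀, ?_⟩
  intro w hw hwBorn
  -- Step 0: a Riemann-regular Born representative `u` of the scattering length of `w`.
  have hfin : scatteringLength w ≠ ⊤ := ScatteringLengthFinite_holds w hw
  obtain ⟨u, hu, huM, huBorn, huReg, hua⟩ :=
    h4 ε₀ hε₀ (scatteringLength w).toReal ENNReal.toReal_nonneg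
  have hsl : scatteringLength u = scatteringLength w := by
    rw [hua, ENNReal.ofReal_toReal hfin]
  have hwM : ∃ M : NNReal, ∀ r, w r ≤ M := by
    obtain ⟨R, -, -, hR⟩ := hwBorn
    exact ⟨(ε₀ / R ^ 2).toNNReal, hR⟩
  -- Step 3 (applied last): universality carries periodic condensation from `u` to `w`.
  refine h3 u w hu hw huM hwM huReg hsl ?_
  -- Steps 1–2 for the regular profile `u`, slice by slice.
  obtain ⟨ρ₀, hρ₀, hρ⟩ := hcorner u hu huBorn
  refine ⟨ρ₀, hρ₀, fun ρ hρpos hρlt => ?_⟩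
  obtain ⟨κ, hκ, hN⟩ := hρ ρ hρpos hρlt
  refine ⟨κ / 2, half_pos hκ, ?_⟩
  filter_upwards [hN, Filter.eventually_ge_atTop 1, Filter.eventually_ge_atTop ⌈6 / κ⌉₊] with N hN1
    hNpos hN6
  obtain ⟨n₀, hn₀⟩ := hN1
  -- Stub 1 on every `n`-slice: the lattice condensate bound with threshold `κ N`.
  have hlat : ∃ n₀ : ℕ, ∀ (n : ℕ) [NeZero n], Even n → n₀ ≤ n →
      LatticeCondensateBound u ρ N n (κ * N) :=
    ⟨n₀, fun n _ hev hle => h1 u ρ N n (κ * N) hu huM hρpos (hn₀ n hev hle)⟩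
  -- Stub 2: the continuum limit at fixed `N`.
  obtain ⟨δ, hδ, hΨ⟩ := h2 u ρ N (κ * N) hu huM huReg hρpos hNpos hlat
  refine ⟨δ, hδ, fun Ψ hE => le_trans (ENNReal.ofReal_le_ofReal ?_) (hΨ Ψ hE)⟩
  -- `κ/2 · N ≤ κ · N − 3` for `N ≥ 6/κ`.
  have h6 : 6 / κ ≤ (N : ℝ) := (Nat.le_ceil (6 / κ)).trans (by exact_mod_cast hN6)
  have h6' : 6 ≤ (N : ℝ) * κ := (div_le_iff₀ hκ).mp h6
  nlinarith [h6', hκ]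

/-- **The skeleton theorem (registered form).** The crux `CornerTransfer` BY NAME — its consequent is,
verbatim up to the shorthands `Born` / `PeriodicCondensation`, the conclusion of
`cornerTransfer_of_parts` — from the four declared stubs BY NAME; no `sorry` of its own, its only
`sorryAx` ancestry is `stub_nonrelativisticLimit`, `stub_continuumLimit`, `stub_periodicUniversality`,
`stub_regularBornRepresentatives`. -/
theorem CornerTransfer_of : CornerTransfer := fun hRel =>
  cornerTransfer_of_parts stub_nonrelativisticLimit stub_continuumLimit stub_periodicUniversality
    stub_regularBornRepresentatives hRel

end Summit.AtomisticToContinuum.BoseEinsteinCondensation.Cruxes.CornerTransfer.Birth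

end
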